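import Mathlib.Algebra.Category.ModuleCat.Basic
import Mathlib.Algebra.DirectSum.Module
import Mathlib.LinearAlgebra.TensorProduct.Tower
import Mathlib.Algebra.BigOperators.Finprod
import Mathlib.Data.Finset.NatAntidiagonal
import Mathlib.AlgebraicGeometry.AlgebraicCycle.Basic
import Mathlib.AlgebraicGeometry.Pullbacks
import Summits.Ventures.HodgeRepro2.HostAPI.Carriers.AlgebraicGeometry.Motives.Varieties
import Summits.Ventures.HodgeRepro2.HostAPI.Carriers.AlgebraicGeometry.Motives.Cycles
import Summits.Ventures.HodgeRepro2.HostAPI.Util.ForallBinderLint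
open HostAPI.Carriers

universe u v

open CategoryTheory AlgebraicGeometry MonoidalCategory CartesianMonoidalCategory Opposite
open scoped TensorProduct DirectSum

noncomputable section

namespace HostAPI.Carriers.AlgebraicGeometry.Motives

structure PreWeilCohomology (k : Type u) [Field k] (K : Type v) [Field K] where

  H : ℕ → (SchemeOver k)ᵒᵖ ⥤ ModuleCat.{u} K

  cup {X : SchemeOver k} {i j n : ℕ} (h : i + j = n) :
    (H i).obj (op X) →ₗ[K] (H j).obj (op X) →ₗ[K] (H n).obj (op X)

  one (X : SchemeOver k) : (H 0).obj (op X)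

  trace (X : SchemeOver k) (n : ℕ) : (H (2 * n)).obj (op X) →ₗ[K] K

  cycleClass (X : SchemeOver k) (p : ℕ) : X.left → (H (2 * p)).obj (op X)

namespace PreWeilCohomology

variable {k : Type u} [Field k] {K : Type v} [Field K] (W : PreWeilCohomology k K)

abbrev obj (X : SchemeOver k) (i : ℕ) : Type u := (W.H i).obj (op X)

section Functoriality

variable {X Y Z : SchemeOver k}

def pullback (f : X ⟶ Y) (i : ℕ) : W.obj Y i →ₗ[K] W.obj X i := ((W.H i).map f.op).hom

@[simp]
lemma pullback_id (i : ℕ) : W.pullback (𝟙 X) i = LinearMap.id := by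
  rw [pullback, op_id, (W.H i).map_id]
  rfl

lemma pullback_comp (f : X ⟶ Y) (g : Y ⟶ Z) (i : ℕ) :
    W.pullback (f ≫ g) i = (W.pullback f i).comp (W.pullback g i) := by
  rw [pullback, op_comp, (W.H i).map_comp]
  rfl

end Functoriality

section Products

variable (X : SchemeOver k)

def cupPairing (n i j : ℕ) (h : i + j = 2 * n) : W.obj X i →ₗ[K] W.obj X j →ₗ[K] K :=
  (W.cup h).compr₂ (W.trace X n)

def pow (η : W.obj X 2) : (r : ℕ) → W.obj X (2 * r)
  | 0 => W.one X
  | r + 1 => W.cup rfl (pow η r) η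

@[simp]
lemma pow_zero (η : W.obj X 2) : W.pow X η 0 = W.one X := rfl

lemma pow_succ (η : W.obj X 2) (r : ℕ) :
    W.pow X η (r + 1) = W.cup rfl (W.pow X η r) η := rfl

def lefschetzPow (η : W.obj X 2) (r i j : ℕ) (h : i + 2 * r = j) : W.obj X i →ₗ[K] W.obj X j :=
  (W.cup h).flip (W.pow X η r)

variable (Y : SchemeOver k)

def externalCup {i j n : ℕ} (h : i + j = n) : W.obj X i →ₗ[K] W.obj Y j →ₗ[K] W.obj (X ⊗ Y) n :=
  ((W.cup h).comp (W.pullback (fst X Y) i)).compl₂ (W.pullback (snd X Y) j)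

noncomputable def kunnethMap (n : ℕ) :
    (⨁ ij : ↥(Finset.antidiagonal n), W.obj X ij.1.1 ⊗[K] W.obj Y ij.1.2) →ₗ[K]
      W.obj (X ⊗ Y) n :=
  DirectSum.toModule K _ _ fun ij ↦
    TensorProduct.lift (W.externalCup X Y (Finset.mem_antidiagonal.mp ij.2))

def transposeClass {X Y} {m : ℕ} (u : W.obj (X ⊗ Y) m) : W.obj (Y ⊗ X) m :=
  W.pullback (β_ Y X).hom m u

end Products

section Cycles

variable (X : SchemeOver k) (p : ℕ)

def cycleMap (c : AlgebraicCycle X.left ℤ) : W.obj X (2 * p) :=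
  ∑ᶠ z, c z • W.cycleClass X p z

lemma finite_support_cycleMap [CompactSpace X.left] (c : AlgebraicCycle X.left ℤ) :
    (Function.support fun z ↦ c z • W.cycleClass X p z).Finite := by
  have h : (Function.support c).Finite := by
    simpa using c.locallyFiniteSupport.finite_inter_support_of_isCompact isCompact_univ
  exact h.subset (Function.support_smul_subset_left (⇑c) (W.cycleClass X p))

@[simp]
lemma cycleMap_zero : W.cycleMap X p 0 = 0 := by
  simp [cycleMap]

lemma cycleMap_add [CompactSpace X.left] (c c' : AlgebraicCycle X.left ℤ) :
    W.cycleMap X p (c + c') = W.cycleMap X p c + W.cycleMap X p c' := by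
  simp only [cycleMap, Function.locallyFinsuppWithin.coe_add, Pi.add_apply, add_smul]
  exact finsum_add_distrib (W.finite_support_cycleMap X p c) (W.finite_support_cycleMap X p c')

def algebraicLattice : AddSubgroup (W.obj X (2 * p)) :=
  AddSubgroup.closure
    (Set.range fun z : {z : X.left // Order.coheight z = p} ↦ W.cycleClass X p z)

def ratAlgebraicClasses : AddSubgroup (W.obj X (2 * p)) where
  carrier := {x | ∃ N : ℤ, N ≠ 0 ∧ N • x ∈ W.algebraicLattice X p}
  zero_mem' := ⟨1, one_ne_zero, by simp⟩
  add_mem' := by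
    rintro x y ⟨N, hN, hx⟩ ⟨M, hM, hy⟩
    refine ⟨N * M, mul_ne_zero hN hM, ?_⟩
    rw [smul_add, mul_comm N M, mul_smul, mul_comm M N, mul_smul]
    exact add_mem (AddSubgroup.zsmul_mem _ hx M) (AddSubgroup.zsmul_mem _ hy N)
  neg_mem' := by
    rintro x ⟨N, hN, hx⟩
    exact ⟨N, hN, by simpa using neg_mem hx⟩

lemma mem_ratAlgebraicClasses_iff {x : W.obj X (2 * p)} :
    x ∈ W.ratAlgebraicClasses X p ↔ ∃ N : ℤ, N ≠ 0 ∧ N • x ∈ W.algebraicLattice X p := Iff.rfl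

def algebraicClasses : Submodule K (W.obj X (2 * p)) :=
  Submodule.span K (W.algebraicLattice X p)

lemma algebraicLattice_le_ratAlgebraicClasses :
    W.algebraicLattice X p ≤ W.ratAlgebraicClasses X p :=
  fun _ hx ↦ ⟨1, one_ne_zero, by simpa using hx⟩

lemma algebraicLattice_le_algebraicClasses :
    W.algebraicLattice X p ≤ (W.algebraicClasses X p).toAddSubgroup :=
  fun _ hx ↦ Submodule.subset_span hx

lemma ratAlgebraicClasses_le_algebraicClasses [CharZero K] :
    W.ratAlgebraicClasses X p ≤ (W.algebraicClasses X p).toAddSubgroup := by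
  rintro x ⟨N, hN, hx⟩
  have hNK : (N : K) ≠ 0 := Int.cast_ne_zero.mpr hN
  have : x = (N : K)⁻¹ • ((N : K) • x) := by rw [smul_smul, inv_mul_cancel₀ hNK, one_smul]
  rw [this]
  refine Submodule.smul_mem _ _ ?_
  rw [Int.cast_smul_eq_zsmul]
  exact Submodule.subset_span hx

lemma cycleClass_mem_algebraicLattice {z : X.left} (hz : Order.coheight z = p) :
    W.cycleClass X p z ∈ W.algebraicLattice X p :=
  AddSubgroup.subset_closure ⟨⟨z, hz⟩, rfl⟩

lemma cycleMap_mem_algebraicLattice {c : AlgebraicCycle X.left ℤ}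
    (hc : c ∈ cyclesOfCodim X.left p) : W.cycleMap X p c ∈ W.algebraicLattice X p := by
  refine finsum_induction (fun x ↦ x ∈ W.algebraicLattice X p) (zero_mem _)
    (fun _ _ hx hy ↦ add_mem hx hy) fun z ↦ ?_
  by_cases hz : c z = 0
  · simp [hz]
  · exact AddSubgroup.zsmul_mem _ (W.cycleClass_mem_algebraicLattice X p (hc z hz)) _

end Cycles

section Correspondences

variable {X Y : SchemeOver k}

def IsInducedBy (nX nY : ℕ) {m i j j' : ℕ} (u : W.obj (X ⊗ Y) m)
    (T : W.obj X i →ₗ[K] W.obj Y j) (hj : j + j' = 2 * nY)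
    (hm : i + m + j' = 2 * (nX + nY)) : Prop :=
  ∀ (x : W.obj X i) (y : W.obj Y j'),
    W.trace Y nY (W.cup hj (T x) y) =
      W.trace (X ⊗ Y) (nX + nY)
        (W.cup hm (W.cup rfl (W.pullback (fst X Y) i x) u) (W.pullback (snd X Y) j' y))

variable (X)

def IsHyperplaneClass (η : W.obj X 2) : Prop :=
  ∃ (e : ProjectiveEmbedding X) (D : AlgebraicCycle (projectiveSpace e.n k).left ℤ),
    D ∈ cyclesOfCodim (projectiveSpace e.n k).left 1 ∧ 0 < D ∧
      η = W.pullback e.ι 2 (W.cycleMap (projectiveSpace e.n k) 1 D)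

end Correspondences

section Graded

variable (X Y : SchemeOver k)

abbrev GradedOp : Type u := ∀ i j : ℕ, W.obj X i →ₗ[K] W.obj Y j

variable {X Y} {Z : SchemeOver k}

namespace GradedOp

variable {W}

def ofLinearMap {i j : ℕ} (T : W.obj X i →ₗ[K] W.obj Y j) : W.GradedOp X Y :=
  fun i' j' ↦ if h : i = i' ∧ j = j' then h.1 ▸ h.2 ▸ T else 0

@[simp]
lemma ofLinearMap_apply_same {i j : ℕ} (T : W.obj X i →ₗ[K] W.obj Y j) :
    ofLinearMap T i j = T := by
  simp only [ofLinearMap, and_self, ↓reduceDIte]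

lemma ofLinearMap_apply_of_ne {i j i' j' : ℕ} (T : W.obj X i →ₗ[K] W.obj Y j)
    (h : ¬ (i = i' ∧ j = j')) : ofLinearMap T i' j' = 0 := by
  simp only [ofLinearMap, h, ↓reduceDIte]

def comp (S : W.GradedOp Y Z) (T : W.GradedOp X Y) : W.GradedOp X Z :=
  fun i j ↦ ∑ᶠ m, (S m j).comp (T i m)

end GradedOp

variable (X)

def lefschetzOp (η : W.obj X 2) : W.GradedOp X X :=
  fun i j ↦ if h : i + 2 = j then W.lefschetzPow X η 1 i j h else 0

variable {X}

def IsAlgebraicGradedOp (nX nY : ℕ) (T : W.GradedOp X Y) : Prop :=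
  ∃ u : ∀ c : ℕ, ↥(W.ratAlgebraicClasses (X ⊗ Y) c),
    (∀ (i j c j' : ℕ) (hj : j + j' = 2 * nY) (hm : i + 2 * c + j' = 2 * (nX + nY)),
      2 * c + i = j + 2 * nX → W.IsInducedBy nX nY (u c : W.obj (X ⊗ Y) (2 * c)) (T i j) hj hm) ∧
    (∀ i j : ℕ, (¬ ∃ c : ℕ, 2 * c + i = j + 2 * nX) → T i j = 0)

def IsAlgebraicOperator (nX nY : ℕ) {i j : ℕ} (T : W.obj X i →ₗ[K] W.obj Y j) : Prop :=
  W.IsAlgebraicGradedOp nX nY (GradedOp.ofLinearMap T)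

end Graded

end PreWeilCohomology

end HostAPI.Carriers.AlgebraicGeometry.Motives

end
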